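import Mathlib
import HarnessLib
import Summits.HubbardSuperconductivity.HubbardSuperconductivity.Theorems.KLProgrammeKLRegimeTwoVolumeTopFrameGridData
import Summits.HubbardSuperconductivity.HubbardSuperconductivity.Theorems.KLProgrammeKLRegimeUVCovarianceTailsAt

/-!
# Route `KLProgramme` — crux K3, VL child `KLRegimeVolumeLimitV17F2` (stmt-HubbardSuperconductivity-20440), (vi) blueprint v5 §1 BASE / §4 «M4b-Λ₁»:
# ONE-VOLUME GRID DATA OF THE UV COVARIANCE `G^K_{>Λ} = S_gᵀ·C^K_{>Λ}·S_g` AT A GENERAL CUTOFF `Λ ∈ [Λ₁, Λ₀]` AND AN ADMISSIBLE FRAME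
# (cell gate-hubbard-kl, seat hubbard-kl-k3c4-p2 g13 — the «UV lane»; `--supports` stmt-…-20440)

Blueprint v5 (k3c4-p1 g12, evidence #41) moves the BASE of the doubled two-volume tower from `Λ₀ = klE0` to `Λ₁ = klScale klE0 1` (the slice
`(Λ₁, Λ₀]` lies in no thin plateau): `Y_V := effAction (S_gridᵀ C^{K_V}_{>Λ₁} S_grid) (V_N + 𝒩_{K_V})`, `map S_grid Y_V = 𝒱_1[K_V]`; M4a
(`hubbardGrid_sum_norm_kernel_twoVolume_stepZero_le`, generic in the sampled symbol) then reads «M4b at cutoff `Λ₁`» = the `Λ₁` twin of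
`…TwoVolumeTopFrameGridData` (p580556, written at `Λ₀`).  This file is that twin on the `2(2M)` grid at an admissible frame `FrameOK R U Nsc μ K`:
* §0 `klEffectiveAction_eq_map_gridSub` — `𝒱_j[K] = map S_N (effAction (S_Nᵀ C^K_{>Λ_j} S_N) (V_N + 𝒩_K))` at EVERY scale `j`, every grid
  `4M ≤ N + 1`, `2M ≤ N` (scale `0`: `klEffectiveAction_zero_eq_map_gridSub`, p527378) — blueprint §1's `map S_grid Y_V = 𝒱_1[K_V]`;
* §1 GRAM at every `Λ ∈ [Λ₁, Λ₀]` and every `klBetaMin ≤ β ≤ L`, WITHOUT the hypothesis `π/β ≤ Λ` of `infraredGram_frame_le` (false at `Λ₁` for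
  `β < 128π`): `(1 − w_Λ) = (1 − w_{Λ₀}) + (w_{Λ₀} − w_Λ)` — `infraredGram_frame_le` at `Λ₀` (`≤ 6047·βL²`) plus `sliceGram_frame_le` on `(Λ, Λ₀]`
  (`≤ 546·βL²`): `infraredSum_uvCovAt_le` (`κ² ≤ 6593`), **`isDetBoundedR_/isGramBoundedR_uvCovAt_of_frameOK`** (`√(2(7+6593))`), `norm_uvCovAt_apply_le`;
* §2 ROWS: (a) GENERIC — every row datum M4a reads (`(1+tnorm)`, plain, `tnorm`, reduced `tnorm` mod `Lc ∣ L`, far tails) from ANY `gridLabelWt`-row/column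
  bound `αw` (`gridRowData_of_rowWt_colWt`); (b) `rowWt_/colWt_uvCovAt_le` at every `0 < Λ ≤ Λ₀` under `klEngL₃ ≤ L`, `klEngM₃ ≤ M`, `|U| ≤ 1`:
  `≤ (N/β)·A(Λ, R, Nsc, U)`, `A` = the closed value of `UVCovarianceAt.rowSum_uvCov_gridLabelWt_le` at `B = klCutoffX5`; `uvAlphaAt_le_uniform` — the
  `(Nsc, U)`-free majorant under `(Nsc+1)U² + 2|U| ≤ 3` (twin of `frameAlphaOne_le_klE3A1`; `Λ₁` is a pure number, so the constant is `β`-free);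
* §3 `frame_gridDataAt` — Gram + unit grid partition function + `(1+diam_{tnorm})`-weighted pinned profile of `effAction G^K_{>Λ} (V_N + 𝒩_K)` from
  `gridLabelWt` rows `≤ αw` and `θ < 1` (`isUnit_and_weightedProfile_of_gridData`), every `Λ ∈ [Λ₁, Λ₀]`.
The fixed-time sectional sums `hsec` at any `Λ` are `sum_far_norm_gridSub_hubbardCovAboveCT_sectional_le_of_frameOK` (p544735).
Sorry-free; no definition; no named fact.  References: BGM 2006 §2 (2.80); Pedra–Salmhofer 2008 Thm 1.3; Salmhofer 1998 Prop. 1.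
-/

noncomputable section

namespace Summit.HubbardSuperconductivity.HubbardSuperconductivity.Theorems.TwoVolumeDefect

set_option linter.dupNamespace false -- summit = problem name (single-conjunct summit), D-0017

open Finset Literature.MathematicalPhysics.QuantumLattice GrassmannAlgebra Literature.Probability.LatticeModels
  Literature.Probability.LatticeModels.BattleFederbush
open Summit.HubbardSuperconductivity.HubbardSuperconductivity.Theorems.EngineV8
open Summit.HubbardSuperconductivity.HubbardSuperconductivity.Theorems.KLRegimeSplit
open Summit.HubbardSuperconductivity.HubbardSuperconductivity.Theorems.UVCovarianceAt
open Summit.HubbardSuperconductivity.HubbardSuperconductivity.Theorems.KLProgrammeLegKernels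
open Summit.HubbardSuperconductivity.HubbardSuperconductivity.Theorems.ScaleZeroDecay

/-! ## §0 The scale-`j` effective action is the momentum image of the grid effective action at cutoff `Λ_j`, on every grid `N ≥ 4M` -/

section Identity

variable {L M : ℕ} [NeZero L]

/-- **`𝒱_j[K] = map S_N (effAction (S_Nᵀ C^K_{>Λ_j} S_N) (V_N + 𝒩_K))` at EVERY scale `j`** on every grid with `4M ≤ N + 1`, `2M ≤ N` (`β ≠ 0`,
any cutoff unit `e₀`): the blueprint's base object `Y_V := effAction (S_gridᵀ C^{K}_{>Λ_1} S_grid) (V_N + 𝒩_K)` satisfies `map S_grid Y_V = 𝒱_1[K]`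
(`j = 1`, `N = 4M`).  The case `j = 0` is `klEffectiveAction_zero_eq_map_gridSub`. -/
theorem klEffectiveAction_eq_map_gridSub [NeZero M] {N : ℕ} [NeZero N] {β : ℝ} (hβ : β ≠ 0) (U μ : ℝ) (K : TrigPolyC4v) (e₀ : ℝ) (j : ℕ)
    (hN : 4 * M ≤ N + 1) (hN2 : 2 * M ≤ N) :
    klEffectiveAction L M β U μ K e₀ j =
      ExteriorAlgebra.map (Matrix.toLin' (hubbardGridSub L M β N))
        (effAction ℂ ((hubbardGridSub L M β N).transpose * hubbardCovAboveCT L M β μ 0 K (klScale e₀ j) * hubbardGridSub L M β N)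
          (hubbardGridInteraction L N β U + hubbardGridCounterQuadratic L N β K)) := by
  rw [klEffectiveAction, hubbardEffectiveActionCT, hubbardInteractionCT, ← map_hubbardGridSub_gridInteraction hβ U hN,
    ← map_hubbardGridSub_gridCounterQuadratic hβ K hN2, ← map_add, effAction_map, LinearMap.toMatrix'_toLin']

end Identity

/-! ## §1 The Gram property of `G^K_{>Λ}` at every cutoff `Λ ∈ [Λ₁, Λ₀]`, every `klBetaMin ≤ β ≤ L` -/

section Gram

variable {L M : ℕ} [NeZero L]

/-- The infrared sum at a lower cutoff is at most the one at a higher cutoff plus the slice sum (termwise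
`1 − w_Λ = (1 − w_{Λ′}) + (w_{Λ′} − w_Λ) ≤ (1 − w_{Λ′}) + |w_Λ − w_{Λ′}|`, the weights `1/√(ω² + e²)` being nonnegative). -/
theorem infraredSum_le_add_sliceSum (β μ : ℝ) (K : TrigPolyC4v) (Λ Λ' : ℝ) :
    ∑ k : FreqMomentum L M, (1 - hubbardCutoffWeightCT L M β μ K Λ k) / Real.sqrt (matsubaraFreq β M k.1 ^ 2 + nambuXiCT L μ K k.2 ^ 2) ≤
      ∑ k : FreqMomentum L M, (1 - hubbardCutoffWeightCT L M β μ K Λ' k) / Real.sqrt (matsubaraFreq β M k.1 ^ 2 + nambuXiCT L μ K k.2 ^ 2) +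
        ∑ k : FreqMomentum L M, |hubbardCutoffWeightCT L M β μ K Λ k - hubbardCutoffWeightCT L M β μ K Λ' k| /
          Real.sqrt (matsubaraFreq β M k.1 ^ 2 + nambuXiCT L μ K k.2 ^ 2) := by
  rw [← sum_add_distrib]
  refine sum_le_sum fun k _ => ?_
  rw [← add_div]
  refine div_le_div_of_nonneg_right ?_ (Real.sqrt_nonneg _)
  have h := le_abs_self (hubbardCutoffWeightCT L M β μ K Λ' k - hubbardCutoffWeightCT L M β μ K Λ k)
  rw [abs_sub_comm] at h
  linarith

/-- **The infrared Gram input at every cutoff `Λ ∈ [Λ₁, Λ₀]`, for every `klBetaMin ≤ β ≤ L`** (the hypothesis `hIR` of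
`isDetBoundedR_gridSub_hubbardCovAboveCT`): `(βL²)⁻¹·Σ_{(ω,k⃗)} (1 − w^K_Λ)/√(ω² + e_K²) ≤ (√6593)²`
(`6047` from `infraredGram_frame_le` at `Λ₀` plus `≤ 546` from `sliceGram_frame_le` on `(Λ, Λ₀]`, using `128 ≤ β ≤ L`). -/
theorem infraredSum_uvCovAt_le {R : RenConsts} {U : ℝ} {Nsc : ℕ} {μ : ℝ} {K : TrigPolyC4v} (hK : FrameOK R U Nsc μ K)
    {β : ℝ} (hβ : klBetaMin ≤ β) (hβL : β ≤ L) {Λ : ℝ} (hΛ1 : klScale klE0 1 ≤ Λ) (hΛe : Λ ≤ klE0) :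
    1 / (β * (L : ℝ) ^ 2) * ∑ k : FreqMomentum L M,
        (1 - hubbardCutoffWeightCT L M β μ K Λ k) / Real.sqrt (matsubaraFreq β M k.1 ^ 2 + nambuXiCT L μ K k.2 ^ 2) ≤
      (Real.sqrt 6593) ^ 2 := by
  have h128 : (128 : ℝ) ≤ β := by simpa [klBetaMin] using hβ
  have hβpos : 0 < β := by linarith
  have hLβ : (128 : ℝ) ≤ L := h128.trans hβL
  have he₀ : (0 : ℝ) < klE0 := by norm_num [klE0]
  have he₀' : klE0 ≤ 3 / 80 := by norm_num [klE0]
  have hπβ : Real.pi / β ≤ klE0 := by rw [div_le_iff₀ hβpos, klE0]; nlinarith [Real.pi_lt_four]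
  have hΛ1v : klScale klE0 1 = 1 / 128 := by norm_num [klScale, klE0]
  have hΛpos : 0 < Λ := lt_of_lt_of_le (by rw [hΛ1v]; norm_num) hΛ1
  -- the two pieces: infrared sum at `Λ₀` and the slice `(Λ, Λ₀]`
  have hsum := (infraredSum_le_add_sliceSum (L := L) (M := M) β μ K Λ klE0).trans (add_le_add
    (infraredGram_frame_le (L := L) (M := M) hK hβpos he₀ hπβ he₀' hβL) (sliceGram_frame_le (L := L) (M := M) hK hβpos hΛpos hΛe he₀'))
  rw [Real.sq_sqrt (by norm_num)]
  have hβL2 : 0 < β * (L : ℝ) ^ 2 := by positivity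
  rw [one_div, inv_mul_le_iff₀ hβL2]
  refine hsum.trans ?_
  -- numerics: `2/Λ ≤ 256`, `π > 3.1415`, `128 ≤ β ≤ L`
  have h2Λ : 2 / Λ ≤ 256 := by rw [div_le_iff₀ hΛpos]; rw [hΛ1v] at hΛ1; linarith
  have hπ := Real.pi_gt_d4
  have h4 : 0 ≤ klE0 * β / Real.pi := by rw [klE0]; positivity
  have h5 : 0 ≤ 1793 * klE0 * (L : ℝ) ^ 2 + 704 * L := by rw [klE0]; positivity
  have hA : (klE0 * β / Real.pi + 3) * (1793 * klE0 * (L : ℝ) ^ 2 + 704 * L) ≤ (β / 100 + 3) * (57 * (L : ℝ) ^ 2 + 704 * L) := by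
    have h1 : klE0 * β / Real.pi ≤ β / 100 := by rw [klE0, div_le_div_iff₀ Real.pi_pos (by norm_num : (0 : ℝ) < 100)]; nlinarith
    have h2 : 1793 * klE0 * (L : ℝ) ^ 2 ≤ 57 * (L : ℝ) ^ 2 := by rw [klE0]; nlinarith [sq_nonneg (L : ℝ)]
    calc (klE0 * β / Real.pi + 3) * (1793 * klE0 * (L : ℝ) ^ 2 + 704 * L)
        ≤ (klE0 * β / Real.pi + 3) * (57 * (L : ℝ) ^ 2 + 704 * L) := by gcongr
      _ ≤ (β / 100 + 3) * (57 * (L : ℝ) ^ 2 + 704 * L) := by gcongr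
  have hB : 2 / Λ * ((klE0 * β / Real.pi + 3) * (1793 * klE0 * (L : ℝ) ^ 2 + 704 * L)) ≤ 256 * ((β / 100 + 3) * (57 * (L : ℝ) ^ 2 + 704 * L)) :=
    calc 2 / Λ * ((klE0 * β / Real.pi + 3) * (1793 * klE0 * (L : ℝ) ^ 2 + 704 * L))
        ≤ 256 * ((klE0 * β / Real.pi + 3) * (1793 * klE0 * (L : ℝ) ^ 2 + 704 * L)) := mul_le_mul_of_nonneg_right h2Λ (by positivity)
      _ ≤ 256 * ((β / 100 + 3) * (57 * (L : ℝ) ^ 2 + 704 * L)) := by gcongr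
  have hC : (7 * 1793 * klE0 + (klE0 + 8) * 704) * β * (L : ℝ) ^ 2 ≤ 6047 * (β * (L : ℝ) ^ 2) := by rw [klE0]; nlinarith [hβL2]
  -- `256·(β/100 + 3)(57L² + 704L) ≤ 546·βL²` from `128 ≤ β ≤ L`
  have hL2 : (L : ℝ) ^ 2 ≤ β * (L : ℝ) ^ 2 / 128 := by rw [le_div_iff₀ (by norm_num : (0:ℝ) < 128)]; nlinarith [sq_nonneg (L : ℝ)]
  have hβL1 : β * (L : ℝ) ≤ β * (L : ℝ) ^ 2 / 128 := by rw [le_div_iff₀ (by norm_num : (0:ℝ) < 128)]; nlinarith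
  have hL1 : (L : ℝ) ≤ β * (L : ℝ) ^ 2 / (128 * 128) := by rw [le_div_iff₀ (by norm_num : (0:ℝ) < 128 * 128)]; nlinarith
  nlinarith

/-- **`G^K_{>Λ}` is determinant-bounded with `√(2(7+6593))` at every cutoff `Λ ∈ [Λ₁, Λ₀]`**, every admissible frame, every `klBetaMin ≤ β ≤ L`,
every Matsubara cutoff `M ≥ 1`, on the `2(2M)` grid (charge-`0` legs as rows). -/
theorem isDetBoundedR_uvCovAt_of_frameOK {R : RenConsts} {U : ℝ} {Nsc : ℕ} {μ : ℝ} {K : TrigPolyC4v} (hK : FrameOK R U Nsc μ K)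
    {β : ℝ} (hβ : klBetaMin ≤ β) [NeZero M] (hβL : β ≤ L) {Λ : ℝ} (hΛ1 : klScale klE0 1 ≤ Λ) (hΛe : Λ ≤ klE0) :
    IsDetBoundedR (fun X : GridLeg (GridPoint L (2 * (2 * M))) => decide (X.2 = 0))
      ((hubbardGridSub L M β (2 * (2 * M))).transpose * hubbardCovAboveCT L M β μ 0 K Λ * hubbardGridSub L M β (2 * (2 * M)))
      (Real.sqrt (2 * (7 + 6593))) := by
  have hβpos : 0 < β := beta_pos_of_klBetaMin_le hβ
  have h := isDetBoundedR_gridSub_hubbardCovAboveCT (L := L) (M := M) hβpos μ K Λ (infraredSum_uvCovAt_le (L := L) (M := M) hK hβ hβL hΛ1 hΛe)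
  rwa [Real.sq_sqrt (by norm_num)] at h

/-- **`G^K_{>Λ}` is replica-Gram-bounded with `√(2(7+6593))` at every cutoff `Λ ∈ [Λ₁, Λ₀]`** (the covariance hypothesis `hGB`/`hGB′` of M4a for
the base step at `Λ₁`), every admissible frame, every `klBetaMin ≤ β ≤ L`, every `M ≥ 1`. -/
theorem isGramBoundedR_uvCovAt_of_frameOK {R : RenConsts} {U : ℝ} {Nsc : ℕ} {μ : ℝ} {K : TrigPolyC4v} (hK : FrameOK R U Nsc μ K)
    {β : ℝ} (hβ : klBetaMin ≤ β) [NeZero M] (hβL : β ≤ L) {Λ : ℝ} (hΛ1 : klScale klE0 1 ≤ Λ) (hΛe : Λ ≤ klE0) :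
    IsGramBoundedR
      ((hubbardGridSub L M β (2 * (2 * M))).transpose * hubbardCovAboveCT L M β μ 0 K Λ * hubbardGridSub L M β (2 * (2 * M)))
      (Real.sqrt (2 * (7 + 6593))) :=
  (isDetBoundedR_uvCovAt_of_frameOK (L := L) hK hβ hβL hΛ1 hΛe).isGramBoundedR
    (fun _ _ h => gridSub_hubbardCovAboveCT_apply_of_charge_eq β μ K Λ (2 * (2 * M)) h) (Real.sqrt_nonneg _)

/-- **Sup entry `‖G^K_{>Λ} X Y‖ ≤ 2(7+6593)`** at every `Λ ∈ [Λ₁, Λ₀]`, admissible frame, `klBetaMin ≤ β ≤ L` (the `hs`/`hs′` of M4a). -/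
theorem norm_uvCovAt_apply_le {R : RenConsts} {U : ℝ} {Nsc : ℕ} {μ : ℝ} {K : TrigPolyC4v} (hK : FrameOK R U Nsc μ K)
    {β : ℝ} (hβ : klBetaMin ≤ β) [NeZero M] (hβL : β ≤ L) {Λ : ℝ} (hΛ1 : klScale klE0 1 ≤ Λ) (hΛe : Λ ≤ klE0)
    (X Y : GridLeg (GridPoint L (2 * (2 * M)))) :
    ‖((hubbardGridSub L M β (2 * (2 * M))).transpose * hubbardCovAboveCT L M β μ 0 K Λ * hubbardGridSub L M β (2 * (2 * M))) X Y‖ ≤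
      2 * (7 + 6593) := by
  have h := norm_gridSub_hubbardCovAboveCT_apply_le_of_isGramBoundedR (L := L) (M := M) (N := 2 * (2 * M)) μ K Λ
    (isGramBoundedR_uvCovAt_of_frameOK (L := L) (M := M) hK hβ hβL hΛ1 hΛe) X Y
  rwa [Real.sq_sqrt (by norm_num)] at h

end Gram

/-! ## §2a Generic: every row datum of a grid covariance from its `gridLabelWt`-weighted rows and columns -/

section Kit

variable {L M : ℕ} [NeZero L] {β : ℝ}
  (G : Matrix (GridLeg (GridPoint L (2 * (2 * M)))) (GridLeg (GridPoint L (2 * (2 * M)))) ℂ)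

/-- `(1 + tnorm)`-weighted ROW sum `≤ αw` from the `gridLabelWt`-weighted row sum `≤ αw` (`0 ≤ β`). -/
theorem rowOneAddTnorm_le_of_rowWt (hβ0 : 0 ≤ β) {αw : ℝ} (X : GridLeg (GridPoint L (2 * (2 * M))))
    (hrow : ∑ Y, ‖G X Y‖ * gridLabelWt L (2 * (2 * M)) β {gridLegPos X, gridLegPos Y} ≤ αw) :
    ∑ Y, ‖G X Y‖ * (1 + (Torus.tnorm (X.1.1.2 - Y.1.1.2) : ℝ)) ≤ αw :=
  (sum_le_sum fun Y _ => mul_le_mul_of_nonneg_left (one_add_tnorm_le_gridLabelWt_pair hβ0 X Y) (norm_nonneg _)).trans hrow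

/-- `(1 + tnorm)`-weighted COLUMN sum `≤ αw` from the `gridLabelWt`-weighted column sum `≤ αw` (`0 ≤ β`). -/
theorem colOneAddTnorm_le_of_colWt (hβ0 : 0 ≤ β) {αw : ℝ} (Y : GridLeg (GridPoint L (2 * (2 * M))))
    (hcol : ∑ X, ‖G X Y‖ * gridLabelWt L (2 * (2 * M)) β {gridLegPos X, gridLegPos Y} ≤ αw) :
    ∑ X, ‖G X Y‖ * (1 + (Torus.tnorm (X.1.1.2 - Y.1.1.2) : ℝ)) ≤ αw :=
  (sum_le_sum fun X _ => mul_le_mul_of_nonneg_left (one_add_tnorm_le_gridLabelWt_pair hβ0 X Y) (norm_nonneg _)).trans hcol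

/-- Plain ROW sum `≤ αw` from the `(1 + tnorm)`-weighted one. -/
theorem row_le_of_rowOneAddTnorm {αw : ℝ} (X : GridLeg (GridPoint L (2 * (2 * M))))
    (hrow : ∑ Y, ‖G X Y‖ * (1 + (Torus.tnorm (X.1.1.2 - Y.1.1.2) : ℝ)) ≤ αw) : ∑ Y, ‖G X Y‖ ≤ αw := by
  refine le_trans (sum_le_sum fun Y _ => ?_) hrow
  have h0 := norm_nonneg (G X Y)
  have h1 : (0 : ℝ) ≤ (Torus.tnorm (X.1.1.2 - Y.1.1.2) : ℝ) := Nat.cast_nonneg _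
  nlinarith

/-- Plain COLUMN sum `≤ αw` from the `(1 + tnorm)`-weighted one. -/
theorem col_le_of_colOneAddTnorm {αw : ℝ} (Y : GridLeg (GridPoint L (2 * (2 * M))))
    (hcol : ∑ X, ‖G X Y‖ * (1 + (Torus.tnorm (X.1.1.2 - Y.1.1.2) : ℝ)) ≤ αw) : ∑ X, ‖G X Y‖ ≤ αw := by
  refine le_trans (sum_le_sum fun X _ => ?_) hcol
  have h0 := norm_nonneg (G X Y)
  have h1 : (0 : ℝ) ≤ (Torus.tnorm (X.1.1.2 - Y.1.1.2) : ℝ) := Nat.cast_nonneg _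
  nlinarith

/-- `tnorm`-weighted ROW sum (first moment) `≤ αw` from the `(1 + tnorm)`-weighted one. -/
theorem rowTnorm_le_of_rowOneAddTnorm {αw : ℝ} (X : GridLeg (GridPoint L (2 * (2 * M))))
    (hrow : ∑ Y, ‖G X Y‖ * (1 + (Torus.tnorm (X.1.1.2 - Y.1.1.2) : ℝ)) ≤ αw) :
    ∑ Y, ‖G X Y‖ * (Torus.tnorm (X.1.1.2 - Y.1.1.2) : ℝ) ≤ αw := by
  refine le_trans (sum_le_sum fun Y _ => ?_) hrow
  have h0 := norm_nonneg (G X Y)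
  nlinarith

/-- `(1 + reduced tnorm)`-weighted ROW sum `≤ αw` (coarse residues mod `Lc ∣ L`) from the `(1 + tnorm)`-weighted one. -/
theorem rowOneAddTnormReduce_le_of_rowOneAddTnorm {Lc : ℕ} [NeZero Lc] (hLc : Lc ∣ L) {αw : ℝ} (X : GridLeg (GridPoint L (2 * (2 * M))))
    (hrow : ∑ Y, ‖G X Y‖ * (1 + (Torus.tnorm (X.1.1.2 - Y.1.1.2) : ℝ)) ≤ αw) :
    ∑ Y, ‖G X Y‖ * (1 + (Torus.tnorm ((fun i => (((X.1.1.2 i).val : ℕ) : ZMod Lc)) - fun i => (((Y.1.1.2 i).val : ℕ) : ZMod Lc)) : ℝ)) ≤ αw := by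
  refine le_trans (sum_le_sum fun Y _ => mul_le_mul_of_nonneg_left ?_ (norm_nonneg _)) hrow
  simp only [add_le_add_iff_left]
  exact_mod_cast tnorm_reduce_sub_reduce_le hLc _ _

/-- `(1 + reduced tnorm)`-weighted COLUMN sum `≤ αw` from the `(1 + tnorm)`-weighted one. -/
theorem colOneAddTnormReduce_le_of_colOneAddTnorm {Lc : ℕ} [NeZero Lc] (hLc : Lc ∣ L) {αw : ℝ} (Y : GridLeg (GridPoint L (2 * (2 * M))))
    (hcol : ∑ X, ‖G X Y‖ * (1 + (Torus.tnorm (X.1.1.2 - Y.1.1.2) : ℝ)) ≤ αw) :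
    ∑ X, ‖G X Y‖ * (1 + (Torus.tnorm ((fun i => (((X.1.1.2 i).val : ℕ) : ZMod Lc)) - fun i => (((Y.1.1.2 i).val : ℕ) : ZMod Lc)) : ℝ)) ≤ αw := by
  refine le_trans (sum_le_sum fun X _ => mul_le_mul_of_nonneg_left ?_ (norm_nonneg _)) hcol
  simp only [add_le_add_iff_left]
  exact_mod_cast tnorm_reduce_sub_reduce_le hLc _ _

/-- Reduced-`tnorm`-weighted ROW sum `≤ αw` from the `(1 + tnorm)`-weighted one. -/
theorem rowTnormReduce_le_of_rowOneAddTnorm {Lc : ℕ} [NeZero Lc] (hLc : Lc ∣ L) {αw : ℝ} (X : GridLeg (GridPoint L (2 * (2 * M))))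
    (hrow : ∑ Y, ‖G X Y‖ * (1 + (Torus.tnorm (X.1.1.2 - Y.1.1.2) : ℝ)) ≤ αw) :
    ∑ Y, ‖G X Y‖ * (Torus.tnorm ((fun i => (((X.1.1.2 i).val : ℕ) : ZMod Lc)) - fun i => (((Y.1.1.2 i).val : ℕ) : ZMod Lc)) : ℝ) ≤ αw :=
  (sum_norm_mul_tnorm_reduce_le hLc G X).trans (rowTnorm_le_of_rowOneAddTnorm G X hrow)

/-- **ALL ROW DATA FROM THE TWO WEIGHTED BOUNDS**: if the `gridLabelWt`-weighted rows and columns of `G` are `≤ αw` (`0 ≤ β`), then for every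
`Lc ∣ L`: `(1+tnorm)`-rows/cols, plain rows/cols, `tnorm`-rows, `(1 + reduced tnorm)`-rows/cols, reduced-`tnorm`-rows are `≤ αw` and the
all-times far row tails are `≤ αw/(R′+1)` (the shapes M4a / the STEP read). -/
theorem gridRowData_of_rowWt_colWt (hβ0 : 0 ≤ β) {αw : ℝ}
    (hrow : ∀ X, ∑ Y, ‖G X Y‖ * gridLabelWt L (2 * (2 * M)) β {gridLegPos X, gridLegPos Y} ≤ αw)
    (hcol : ∀ Y, ∑ X, ‖G X Y‖ * gridLabelWt L (2 * (2 * M)) β {gridLegPos X, gridLegPos Y} ≤ αw) {Lc : ℕ} [NeZero Lc] (hLc : Lc ∣ L) :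
    (∀ X, ∑ Y, ‖G X Y‖ * (1 + (Torus.tnorm (X.1.1.2 - Y.1.1.2) : ℝ)) ≤ αw) ∧
    (∀ Y, ∑ X, ‖G X Y‖ * (1 + (Torus.tnorm (X.1.1.2 - Y.1.1.2) : ℝ)) ≤ αw) ∧
    (∀ X, ∑ Y, ‖G X Y‖ ≤ αw) ∧ (∀ Y, ∑ X, ‖G X Y‖ ≤ αw) ∧
    (∀ X, ∑ Y, ‖G X Y‖ * (Torus.tnorm (X.1.1.2 - Y.1.1.2) : ℝ) ≤ αw) ∧
    (∀ X, ∑ Y, ‖G X Y‖ * (1 + (Torus.tnorm ((fun i => (((X.1.1.2 i).val : ℕ) : ZMod Lc)) - fun i => (((Y.1.1.2 i).val : ℕ) : ZMod Lc)) : ℝ)) ≤ αw) ∧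
    (∀ Y, ∑ X, ‖G X Y‖ * (1 + (Torus.tnorm ((fun i => (((X.1.1.2 i).val : ℕ) : ZMod Lc)) - fun i => (((Y.1.1.2 i).val : ℕ) : ZMod Lc)) : ℝ)) ≤ αw) ∧
    (∀ X, ∑ Y, ‖G X Y‖ * (Torus.tnorm ((fun i => (((X.1.1.2 i).val : ℕ) : ZMod Lc)) - fun i => (((Y.1.1.2 i).val : ℕ) : ZMod Lc)) : ℝ) ≤ αw) ∧
    (∀ (R' : ℕ) X, ∑ Y ∈ univ.filter (fun Y : GridLeg (GridPoint L (2 * (2 * M))) => R' < Torus.tnorm (X.1.1.2 - Y.1.1.2)), ‖G X Y‖ ≤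
      αw / ((R' : ℝ) + 1)) := by
  have hr : ∀ X, ∑ Y, ‖G X Y‖ * (1 + (Torus.tnorm (X.1.1.2 - Y.1.1.2) : ℝ)) ≤ αw := fun X => rowOneAddTnorm_le_of_rowWt G hβ0 X (hrow X)
  have hc : ∀ Y, ∑ X, ‖G X Y‖ * (1 + (Torus.tnorm (X.1.1.2 - Y.1.1.2) : ℝ)) ≤ αw := fun Y => colOneAddTnorm_le_of_colWt G hβ0 Y (hcol Y)
  exact ⟨hr, hc, fun X => row_le_of_rowOneAddTnorm G X (hr X), fun Y => col_le_of_colOneAddTnorm G Y (hc Y),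
    fun X => rowTnorm_le_of_rowOneAddTnorm G X (hr X), fun X => rowOneAddTnormReduce_le_of_rowOneAddTnorm G hLc X (hr X),
    fun Y => colOneAddTnormReduce_le_of_colOneAddTnorm G hLc Y (hc Y), fun X => rowTnormReduce_le_of_rowOneAddTnorm G hLc X (hr X),
    fun R' X => sum_far_norm_le_of_weightedRow G R' X (hr X)⟩

end Kit

/-! ## §2b The `gridLabelWt`-weighted rows and columns of `G^K_{>Λ}` at every `0 < Λ ≤ Λ₀`, and the `(Nsc, U)`-uniform constant -/

section Rows

variable {L M : ℕ} [NeZero L] [NeZero M] {R : RenConsts} {U μ β Λ : ℝ} {Nsc : ℕ} {K : TrigPolyC4v}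

/-- **`gridLabelWt`-weighted ROW sums of `G^K_{>Λ}` at every `0 < Λ ≤ Λ₀`** under the registered thresholds (`klEngL₃ ≤ L`, `klEngM₃ ≤ M`, `|U| ≤ 1`):
`≤ (N/β)·A(Λ, R, Nsc, U)`, `A` = the closed value of `UVCovarianceAt.rowSum_uvCov_gridLabelWt_le` at `B = klCutoffX5` (plain + time + space parts). -/
theorem rowWt_uvCovAt_le (hK : FrameOK R U Nsc μ K) (hR : R.WF) (hU1 : |U| ≤ 1) (hβ : klBetaMin ≤ β) (hL : klEngL₃ β U ≤ L)
    (hM : klEngM₃ β U L ≤ M) (hΛ : 0 < Λ) (hΛe : Λ ≤ klE0) (X : GridLeg (GridPoint L (2 * (2 * M)))) :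
    ∑ Y : GridLeg (GridPoint L (2 * (2 * M))),
        ‖((hubbardGridSub L M β (2 * (2 * M))).transpose * hubbardCovAboveCT L M β μ 0 K Λ * hubbardGridSub L M β (2 * (2 * M))) X Y‖ *
          gridLabelWt L (2 * (2 * M)) β {gridLegPos X, gridLegPos Y} ≤
      ((2 * (2 * M) : ℕ) : ℝ) / β *
        (14 * Real.sqrt ((1 / 2 + 12 / Λ) *
            (2 / Λ + 128 * Real.pi ^ 4 * (4 * (1110 : ℝ) + 6 * (32 / 3) + 2) ^ 2 / Λ +
              2 * Real.pi ^ 5 * (4 * (1110 : ℝ) + 6 * (32 / 3) + 2) ^ 2 / Λ ^ 2 + 1 +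
              Real.pi ^ 4 * ((7 : ℝ) ^ 2 * (4 * (1110 : ℝ) + 6 * (32 / 3) + 2) * (2 / Λ) + 7 * (2 * (32 / 3) + 1)) ^ 2 / Λ ^ 3)) +
          uvTimeMomentConst Λ 7 32 +
          2 * (uvSpaceMomentConst Λ 1 (uvPieceSq Λ (uvBaseQ klCutoffX5 Λ 4) (uvBaseQ' klCutoffX5 Λ 4)) +
            (1 / 4 * Real.sqrt (216 * (1 / Λ + 1 / 2)) *
                ∑ e : Fin 2 × Fin 2, (uvLinV Λ (1 + (e.1 : ℕ) + (e.2 : ℕ)) *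
                    (klCutoffX5 * ((1 + ((e.1 : ℕ) + (e.2 : ℕ)) + 2).factorial : ℝ) * (4 / Λ) ^ (1 + ((e.1 : ℕ) + (e.2 : ℕ)) + 1)) +
                  uvLinD Λ (1 + (e.1 : ℕ) + (e.2 : ℕ)) *
                    (klCutoffX5 * ((1 + ((e.1 : ℕ) + (e.2 : ℕ)) + 3).factorial : ℝ) * (4 / Λ) ^ (1 + ((e.1 : ℕ) + (e.2 : ℕ)) + 2)))) *
              (4608 * (1 + R.Gfr 0 + R.Gfr 1 + R.Gfr 2 + R.Gfr 3) ^ 4 * (((Nsc : ℝ) + 1) * U ^ 2 + 2 * |U|)))) :=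
  rowSum_uvCov_gridLabelWt_le hK hR hU1 hβ (pow_three_le_of_klEng hβ hL hM) (by omega) one_le_klCutoffX5
    norm_iteratedDeriv_salmhoferCutoff_le_klCutoffX5 hΛ hΛe X

/-- **`gridLabelWt`-weighted COLUMN sums of `G^K_{>Λ}` at every `0 < Λ ≤ Λ₀`**, same constant. -/
theorem colWt_uvCovAt_le (hK : FrameOK R U Nsc μ K) (hR : R.WF) (hU1 : |U| ≤ 1) (hβ : klBetaMin ≤ β) (hL : klEngL₃ β U ≤ L)
    (hM : klEngM₃ β U L ≤ M) (hΛ : 0 < Λ) (hΛe : Λ ≤ klE0) (Y : GridLeg (GridPoint L (2 * (2 * M)))) :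
    ∑ X : GridLeg (GridPoint L (2 * (2 * M))),
        ‖((hubbardGridSub L M β (2 * (2 * M))).transpose * hubbardCovAboveCT L M β μ 0 K Λ * hubbardGridSub L M β (2 * (2 * M))) X Y‖ *
          gridLabelWt L (2 * (2 * M)) β {gridLegPos X, gridLegPos Y} ≤
      ((2 * (2 * M) : ℕ) : ℝ) / β *
        (14 * Real.sqrt ((1 / 2 + 12 / Λ) *
            (2 / Λ + 128 * Real.pi ^ 4 * (4 * (1110 : ℝ) + 6 * (32 / 3) + 2) ^ 2 / Λ +
              2 * Real.pi ^ 5 * (4 * (1110 : ℝ) + 6 * (32 / 3) + 2) ^ 2 / Λ ^ 2 + 1 +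
              Real.pi ^ 4 * ((7 : ℝ) ^ 2 * (4 * (1110 : ℝ) + 6 * (32 / 3) + 2) * (2 / Λ) + 7 * (2 * (32 / 3) + 1)) ^ 2 / Λ ^ 3)) +
          uvTimeMomentConst Λ 7 32 +
          2 * (uvSpaceMomentConst Λ 1 (uvPieceSq Λ (uvBaseQ klCutoffX5 Λ 4) (uvBaseQ' klCutoffX5 Λ 4)) +
            (1 / 4 * Real.sqrt (216 * (1 / Λ + 1 / 2)) *
                ∑ e : Fin 2 × Fin 2, (uvLinV Λ (1 + (e.1 : ℕ) + (e.2 : ℕ)) *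
                    (klCutoffX5 * ((1 + ((e.1 : ℕ) + (e.2 : ℕ)) + 2).factorial : ℝ) * (4 / Λ) ^ (1 + ((e.1 : ℕ) + (e.2 : ℕ)) + 1)) +
                  uvLinD Λ (1 + (e.1 : ℕ) + (e.2 : ℕ)) *
                    (klCutoffX5 * ((1 + ((e.1 : ℕ) + (e.2 : ℕ)) + 3).factorial : ℝ) * (4 / Λ) ^ (1 + ((e.1 : ℕ) + (e.2 : ℕ)) + 2)))) *
              (4608 * (1 + R.Gfr 0 + R.Gfr 1 + R.Gfr 2 + R.Gfr 3) ^ 4 * (((Nsc : ℝ) + 1) * U ^ 2 + 2 * |U|)))) :=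
  colSum_uvCov_gridLabelWt_le hK hR hU1 hβ (pow_three_le_of_klEng hβ hL hM) (by omega) one_le_klCutoffX5
    norm_iteratedDeriv_salmhoferCutoff_le_klCutoffX5 hΛ hΛe Y

omit [NeZero L] [NeZero M] in
/-- **The `(Nsc, U)`-uniform row constant** (twin of `frameAlphaOne_le_klE3A1` at a general cutoff): whenever `(Nsc+1)U² + 2|U| ≤ 3` and `0 < Λ`,
`A(Λ, R, Nsc, U) ≤ A⋆(Λ, R)` := the same closed expression with the frame-depth factor `((Nsc+1)U² + 2|U|)` replaced by `3` — free of `β`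
(hence of `Nsc = nScales β`), `U`, `μ`, `L`, `M` and the frame. -/
theorem uvAlphaAt_le_uniform (R : RenConsts) (hΛ : 0 < Λ) (hNU : ((Nsc : ℝ) + 1) * U ^ 2 + 2 * |U| ≤ 3) :
    14 * Real.sqrt ((1 / 2 + 12 / Λ) *
            (2 / Λ + 128 * Real.pi ^ 4 * (4 * (1110 : ℝ) + 6 * (32 / 3) + 2) ^ 2 / Λ +
              2 * Real.pi ^ 5 * (4 * (1110 : ℝ) + 6 * (32 / 3) + 2) ^ 2 / Λ ^ 2 + 1 +
              Real.pi ^ 4 * ((7 : ℝ) ^ 2 * (4 * (1110 : ℝ) + 6 * (32 / 3) + 2) * (2 / Λ) + 7 * (2 * (32 / 3) + 1)) ^ 2 / Λ ^ 3)) +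
          uvTimeMomentConst Λ 7 32 +
          2 * (uvSpaceMomentConst Λ 1 (uvPieceSq Λ (uvBaseQ klCutoffX5 Λ 4) (uvBaseQ' klCutoffX5 Λ 4)) +
            (1 / 4 * Real.sqrt (216 * (1 / Λ + 1 / 2)) *
                ∑ e : Fin 2 × Fin 2, (uvLinV Λ (1 + (e.1 : ℕ) + (e.2 : ℕ)) *
                    (klCutoffX5 * ((1 + ((e.1 : ℕ) + (e.2 : ℕ)) + 2).factorial : ℝ) * (4 / Λ) ^ (1 + ((e.1 : ℕ) + (e.2 : ℕ)) + 1)) +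
                  uvLinD Λ (1 + (e.1 : ℕ) + (e.2 : ℕ)) *
                    (klCutoffX5 * ((1 + ((e.1 : ℕ) + (e.2 : ℕ)) + 3).factorial : ℝ) * (4 / Λ) ^ (1 + ((e.1 : ℕ) + (e.2 : ℕ)) + 2)))) *
              (4608 * (1 + R.Gfr 0 + R.Gfr 1 + R.Gfr 2 + R.Gfr 3) ^ 4 * (((Nsc : ℝ) + 1) * U ^ 2 + 2 * |U|))) ≤
    14 * Real.sqrt ((1 / 2 + 12 / Λ) *
            (2 / Λ + 128 * Real.pi ^ 4 * (4 * (1110 : ℝ) + 6 * (32 / 3) + 2) ^ 2 / Λ +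
              2 * Real.pi ^ 5 * (4 * (1110 : ℝ) + 6 * (32 / 3) + 2) ^ 2 / Λ ^ 2 + 1 +
              Real.pi ^ 4 * ((7 : ℝ) ^ 2 * (4 * (1110 : ℝ) + 6 * (32 / 3) + 2) * (2 / Λ) + 7 * (2 * (32 / 3) + 1)) ^ 2 / Λ ^ 3)) +
          uvTimeMomentConst Λ 7 32 +
          2 * (uvSpaceMomentConst Λ 1 (uvPieceSq Λ (uvBaseQ klCutoffX5 Λ 4) (uvBaseQ' klCutoffX5 Λ 4)) +
            (1 / 4 * Real.sqrt (216 * (1 / Λ + 1 / 2)) *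
                ∑ e : Fin 2 × Fin 2, (uvLinV Λ (1 + (e.1 : ℕ) + (e.2 : ℕ)) *
                    (klCutoffX5 * ((1 + ((e.1 : ℕ) + (e.2 : ℕ)) + 2).factorial : ℝ) * (4 / Λ) ^ (1 + ((e.1 : ℕ) + (e.2 : ℕ)) + 1)) +
                  uvLinD Λ (1 + (e.1 : ℕ) + (e.2 : ℕ)) *
                    (klCutoffX5 * ((1 + ((e.1 : ℕ) + (e.2 : ℕ)) + 3).factorial : ℝ) * (4 / Λ) ^ (1 + ((e.1 : ℕ) + (e.2 : ℕ)) + 2)))) *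
              (4608 * (1 + R.Gfr 0 + R.Gfr 1 + R.Gfr 2 + R.Gfr 3) ^ 4 * 3)) := by
  have hX5 : 0 ≤ klCutoffX5 := zero_le_one.trans one_le_klCutoffX5
  have hY : 0 ≤ 1 / 4 * Real.sqrt (216 * (1 / Λ + 1 / 2)) *
      ∑ e : Fin 2 × Fin 2, (uvLinV Λ (1 + (e.1 : ℕ) + (e.2 : ℕ)) *
          (klCutoffX5 * ((1 + ((e.1 : ℕ) + (e.2 : ℕ)) + 2).factorial : ℝ) * (4 / Λ) ^ (1 + ((e.1 : ℕ) + (e.2 : ℕ)) + 1)) +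
        uvLinD Λ (1 + (e.1 : ℕ) + (e.2 : ℕ)) *
          (klCutoffX5 * ((1 + ((e.1 : ℕ) + (e.2 : ℕ)) + 3).factorial : ℝ) * (4 / Λ) ^ (1 + ((e.1 : ℕ) + (e.2 : ℕ)) + 2))) := by
    refine mul_nonneg (by positivity) (sum_nonneg fun e _ => add_nonneg ?_ ?_)
    · exact mul_nonneg (uvLinV_nonneg hΛ _) (by positivity)
    · exact mul_nonneg (uvLinD_nonneg hΛ _) (by positivity)
  have hG : 0 ≤ 4608 * (1 + R.Gfr 0 + R.Gfr 1 + R.Gfr 2 + R.Gfr 3) ^ 4 := by positivity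
  have hkey : 4608 * (1 + R.Gfr 0 + R.Gfr 1 + R.Gfr 2 + R.Gfr 3) ^ 4 * (((Nsc : ℝ) + 1) * U ^ 2 + 2 * |U|) ≤
      4608 * (1 + R.Gfr 0 + R.Gfr 1 + R.Gfr 2 + R.Gfr 3) ^ 4 * 3 := mul_le_mul_of_nonneg_left hNU hG
  have hmono := mul_le_mul_of_nonneg_left hkey hY
  linarith

end Rows

/-! ## §3 The grid data (Gram, unit, weighted output profile) of `effAction G^K_{>Λ} (V_N + 𝒩_K)` at every `Λ ∈ [Λ₁, Λ₀]` -/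

section Data

variable {L M : ℕ} [NeZero L] [NeZero M] {R : RenConsts} {U μ β Λ : ℝ} {Nsc : ℕ} {K : TrigPolyC4v}

/-- **ONE-VOLUME GRID DATA AT CUTOFF `Λ ∈ [Λ₁, Λ₀]` AND AN ADMISSIBLE FRAME** (the `Λ`-twin of `frame_gridData`, WITH the grid counterterm `𝒩_K`):
Gram property (`κ = √(2(7+6593))`), unit grid partition function and the `(1+diam_{tnorm})`-weighted pinned profile of `effAction G^K_{>Λ} (V_N + 𝒩_K)`,
from the `gridLabelWt`-weighted rows/columns `≤ αw` and `θ = e·αw·normV(κ, ρ, Nv_K)/κ² < 1` — the base object `Y_V` of blueprint v5 at `Λ = Λ₁`. -/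
theorem frame_gridDataAt (hK : FrameOK R U Nsc μ K) (hβ : klBetaMin ≤ β) (hβL : β ≤ L) (hΛ1 : klScale klE0 1 ≤ Λ) (hΛe : Λ ≤ klE0)
    {αw : ℝ} (hαw : 0 < αw)
    (hrow : ∀ X, ∑ Y, ‖((hubbardGridSub L M β (2 * (2 * M))).transpose * hubbardCovAboveCT L M β μ 0 K Λ *
        hubbardGridSub L M β (2 * (2 * M))) X Y‖ * gridLabelWt L (2 * (2 * M)) β {gridLegPos X, gridLegPos Y} ≤ αw)
    (hcol : ∀ Y, ∑ X, ‖((hubbardGridSub L M β (2 * (2 * M))).transpose * hubbardCovAboveCT L M β μ 0 K Λ *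
        hubbardGridSub L M β (2 * (2 * M))) X Y‖ * gridLabelWt L (2 * (2 * M)) β {gridLegPos X, gridLegPos Y} ≤ αw)
    {ρ : ℝ} (hρ : 0 < ρ)
    (hθ : Real.exp 1 * αw * normV (GridLeg (GridPoint L (2 * (2 * M)))) (Real.sqrt (2 * (7 + 6593))) ρ
      (fun m' : ℕ => if m' = 1 then |β| / (2 * (2 * M) : ℕ) * ∑ z : TorusSite 2 L, ‖framePosKernel L K z‖ * (1 + torusSiteDist z 0)
        else if m' = 2 then |U| * |β| / (2 * (2 * M) : ℕ) else 0) / Real.sqrt (2 * (7 + 6593)) ^ 2 < 1) :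
    IsGramBoundedR ((hubbardGridSub L M β (2 * (2 * M))).transpose * hubbardCovAboveCT L M β μ 0 K Λ *
        hubbardGridSub L M β (2 * (2 * M))) (Real.sqrt (2 * (7 + 6593))) ∧
      IsUnit (effPartitionFn ℂ ((hubbardGridSub L M β (2 * (2 * M))).transpose * hubbardCovAboveCT L M β μ 0 K Λ *
        hubbardGridSub L M β (2 * (2 * M))) (hubbardGridInteraction L (2 * (2 * M)) β U + hubbardGridCounterQuadratic L (2 * (2 * M)) β K)) ∧
      ∀ (m' : ℕ) (j : Fin (2 * m')) (x : GridLeg (GridPoint L (2 * (2 * M)))),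
        ∑ Y ∈ univ.filter (fun Y : Fin (2 * m') → GridLeg (GridPoint L (2 * (2 * M))) => Y j = x),
          ‖kernel ℂ (effAction ℂ ((hubbardGridSub L M β (2 * (2 * M))).transpose * hubbardCovAboveCT L M β μ 0 K Λ *
              hubbardGridSub L M β (2 * (2 * M))) (hubbardGridInteraction L (2 * (2 * M)) β U + hubbardGridCounterQuadratic L (2 * (2 * M)) β K))
              (2 * m') Y‖ *
            (1 + labelDiam (fun Y₁ Y₂ : GridLeg (GridPoint L (2 * (2 * M))) => (Torus.tnorm (Y₁.1.1.2 - Y₂.1.1.2) : ℝ)) (univ.image Y)) ≤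
          ρ⁻¹ ^ (2 * m') * (Real.exp 1 * normV (GridLeg (GridPoint L (2 * (2 * M)))) (Real.sqrt (2 * (7 + 6593))) ρ
            (fun m' : ℕ => if m' = 1 then |β| / (2 * (2 * M) : ℕ) * ∑ z : TorusSite 2 L, ‖framePosKernel L K z‖ * (1 + torusSiteDist z 0)
              else if m' = 2 then |U| * |β| / (2 * (2 * M) : ℕ) else 0)) /
            (1 - Real.exp 1 * αw * normV (GridLeg (GridPoint L (2 * (2 * M)))) (Real.sqrt (2 * (7 + 6593))) ρ
              (fun m' : ℕ => if m' = 1 then |β| / (2 * (2 * M) : ℕ) * ∑ z : TorusSite 2 L, ‖framePosKernel L K z‖ * (1 + torusSiteDist z 0)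
                else if m' = 2 then |U| * |β| / (2 * (2 * M) : ℕ) else 0) / Real.sqrt (2 * (7 + 6593)) ^ 2) := by
  classical
  set G := (hubbardGridSub L M β (2 * (2 * M))).transpose * hubbardCovAboveCT L M β μ 0 K Λ * hubbardGridSub L M β (2 * (2 * M)) with hG
  have hβ0 : 0 ≤ β := le_trans (by norm_num [klBetaMin]) hβ
  have hGB : IsGramBoundedR G (Real.sqrt (2 * (7 + 6593))) := isGramBoundedR_uvCovAt_of_frameOK (L := L) (M := M) hK hβ hβL hΛ1 hΛe
  have hκ : 0 < Real.sqrt (2 * (7 + 6593)) := Real.sqrt_pos.2 (by norm_num)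
  have hrow' : ∀ X, ∑ Y, ‖G X Y‖ * (1 + (Torus.tnorm (X.1.1.2 - Y.1.1.2) : ℝ)) ≤ αw := fun X => rowOneAddTnorm_le_of_rowWt G hβ0 X (hrow X)
  have hcol' : ∀ Y, ∑ X, ‖G X Y‖ * (1 + (Torus.tnorm (X.1.1.2 - Y.1.1.2) : ℝ)) ≤ αw := fun Y => colOneAddTnorm_le_of_colWt G hβ0 Y (hcol Y)
  obtain ⟨hZ, hprof⟩ := isUnit_and_weightedProfile_of_gridData (L := L) (Ng := 2 * (2 * M)) G hκ hGB β U K hαw hrow' hcol' hρ hθ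
  exact ⟨hGB, hZ, hprof⟩

end Data

end Summit.HubbardSuperconductivity.HubbardSuperconductivity.Theorems.TwoVolumeDefect

end
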